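import Literature.Analysis.InnerProduct.HilbertComplexEigenvalueComparisonMiddle
import Literature.Analysis.InnerProduct.EigenvalueCountingFunctionComparison
import HarnessLib

/-!
# Brüning–Lesch 1992, Lemma 2.17 (2.52) as printed: `C⁻¹λₙ ≤ λ′ₙ ≤ Cλₙ` for the eigenvalues, in increasing order, of the
# Laplacians `T*T`, `□ = TT* + S*S`, `SS*` of isomorphic discrete Hilbert complexes

Layer `Literature/Analysis/InnerProduct`, namespace `Literature.Analysis.InnerProduct`; sequel BY NAME of
`HilbertComplexEigenvalueComparison.lean` / `HilbertComplexEigenvalueComparisonMiddle.lean` (rows g34-#7/#8: (2.52) in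
counting form, `ncard_eigenvalue_adjointCompSelf_lt_le_of_iso`, `ncard_eigenvalue_selfCompAdjoint_lt_le_of_iso`,
`ncard_eigenvalue_laplacian_comparison_of_iso`) and `EigenvalueCountingFunctionComparison.lean` (row g35-#1: counting form ⟺
termwise along increasing enumerations, `forall_ncard_setOf_lt_le_iff_forall_le_mul`; existence of increasing enumerations,
`exists_equiv_nat_monotone_of_tendsto_cofinite`). Lane `lit-hodgefound` (Track 2 foundations library), prover seat
`lit-hodgefound-p06` (generation 35), self-proposed row g35-#9. THEOREMS ONLY (no definition, no instance, no named fact).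
Hypotheses exactly as in rows g34-#7/#8 (Laplacians hypothesis-parametrised, eigenbases `heig` with `μ → ∞` on both
complexes, an isomorphism `(g_E, g_F, g_G) ⇄ (k_E, k_F, k_G)` with `‖g‖ ≤ M_g`, `‖k‖ ≤ M_k`), plus increasing enumerations
`e : ℕ ≃ ι`, `e′ : ℕ ≃ ι′` of the two eigenvalue families (`λₙ := μ (e n)`, `λ′ₙ := μ′ (e′ n)`).

## Source, verbatim

J. Brüning, M. Lesch, *Hilbert complexes*, J. Funct. Anal. 108 (1992) 88–132, §2 p. 104 (held text
`paper:doi-10-1016-0022-1236-92-90147-b`, p0017): "LEMMA 2.17. Discreteness is invariant under complex isomorphisms. More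
precisely, if `(𝒟, D)` is a discrete Hilbert complex and `g : (𝒟, D) → (𝒟′, D′)` is a complex isomorphism then we have for
the eigenvalues `λₙ`, `λ′ₙ` of `Δ` and `Δ′`: `C⁻¹λₙ ≤ λ′ₙ ≤ Cλₙ`, `n ≥ 1` (2.52), with some constant `C` independent of
`n`."

Rows g34-#7/#8 proved (2.52) as the pair of counting inequalities `#{μ < λ} ≤ #{μ′ < Cλ}`, `#{μ′ < λ} ≤ #{μ < Cλ}` with
`C = (M_g M_k)²`; row g35-#1 proved that, along increasing enumerations, the second says `λₙ ≤ Cλ′ₙ` for all `n` and the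
first (with the roles exchanged) says `λ′ₙ ≤ Cλₙ`. This file records the printed two-sided inequality, degree by degree
(`Δ = ⊕ Δᵢ`), with the explicit constant `C = (M_g M_k)²`.

## What is proved (all over `𝕜 = ℝ` or `ℂ`)

* **`eigenvalue_adjointCompSelf_comparison_termwise_of_iso`** ((2.52) for `Δ₀ = T*T` versus `T′*T′`).
* **`eigenvalue_selfCompAdjoint_comparison_termwise_of_iso`** ((2.52) for `Δ₂ = SS*` versus `S′S′*`).
* **`eigenvalue_laplacian_comparison_termwise_of_iso`** ((2.52) for `Δ₁ = □` versus `□′`).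

## References

* [BruningLesch1992] J. Brüning, M. Lesch, *Hilbert complexes*, J. Funct. Anal. 108 (1992) 88–132, §2 Lemma 2.17 (2.52).
* [Schmudgen2012] K. Schmüdgen, *Unbounded Self-adjoint Operators on Hilbert Space*, GTM 265 (2012), §12.1 Thm 12.1 (through
  rows g34-#7/#8).
-/

noncomputable section

open scoped InnerProductSpace LinearPMap
open Filter Topology

namespace Literature.Analysis.InnerProduct

variable {𝕜 E F G E' F' G' : Type*} [RCLike 𝕜]
variable [NormedAddCommGroup E] [InnerProductSpace 𝕜 E]
variable [NormedAddCommGroup F] [InnerProductSpace 𝕜 F]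
variable [NormedAddCommGroup G] [InnerProductSpace 𝕜 G]
variable [NormedAddCommGroup E'] [InnerProductSpace 𝕜 E']
variable [NormedAddCommGroup F'] [InnerProductSpace 𝕜 F']
variable [NormedAddCommGroup G'] [InnerProductSpace 𝕜 G']

/-- From the pair of counting inequalities to the printed two-sided termwise inequality. [cite: BruningLesch1992, §2 Lemma
2.17 (2.52)] -/
private theorem termwise_of_counting {ι ι' : Type*} {μ : ι → ℝ} {μ' : ι' → ℝ} (htend : Tendsto μ cofinite atTop)
    (htend' : Tendsto μ' cofinite atTop) {C : ℝ} (hC : 0 < C)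
    (h : ∀ l : ℝ, {i | μ i < l}.ncard ≤ {j | μ' j < C * l}.ncard ∧ {j | μ' j < l}.ncard ≤ {i | μ i < C * l}.ncard)
    (e : ℕ ≃ ι) (he : Monotone (μ ∘ e)) (e' : ℕ ≃ ι') (he' : Monotone (μ' ∘ e')) (n : ℕ) :
    C⁻¹ * μ (e n) ≤ μ' (e' n) ∧ μ' (e' n) ≤ C * μ (e n) := by
  have h1 := (forall_ncard_setOf_lt_le_iff_forall_le_mul htend htend' hC e he e' he').1 (fun l ↦ (h l).2) n
  have h2 := (forall_ncard_setOf_lt_le_iff_forall_le_mul htend' htend hC e' he' e he).1 (fun l ↦ (h l).1) n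
  refine ⟨?_, h2⟩
  rw [inv_mul_le_iff₀ hC]
  exact h1

/-! ### §1 (2.52) for `Δ₀ = T*T` -/

section DegreeZero

variable [CompleteSpace E] [CompleteSpace E']
variable {T : E →ₗ.[𝕜] F} {A : E →ₗ.[𝕜] E} {ι : Type*} {b : HilbertBasis ι 𝕜 E} {μ : ι → ℝ}
variable {T' : E' →ₗ.[𝕜] F'} {A' : E' →ₗ.[𝕜] E'} {ι' : Type*} {b' : HilbertBasis ι' 𝕜 E'} {μ' : ι' → ℝ}
variable {g_E : E →L[𝕜] E'} {g_F : F →L[𝕜] F'} {k_E : E' →L[𝕜] E} {k_F : F' →L[𝕜] F}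

omit [NormedAddCommGroup G] [InnerProductSpace 𝕜 G] [NormedAddCommGroup G'] [InnerProductSpace 𝕜 G'] in
/-- **LEMMA 2.17 (2.52), degree `0`, as printed**: for `T*T` and `T′*T′` of isomorphic discrete complexes
(`(g_E, g_F) ⇄ (k_E, k_F)`, `‖g‖ ≤ M_g`, `‖k‖ ≤ M_k`) and increasing enumerations `λₙ = μ(e n)`, `λ′ₙ = μ′(e′ n)` of
their eigenvalues (counted with multiplicity): `C⁻¹λₙ ≤ λ′ₙ ≤ Cλₙ` for every `n`, with `C = (M_g M_k)²` "independent of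
`n`". [cite: BruningLesch1992, §2 Lemma 2.17 (2.52); Schmudgen2012, §12.1 Thm 12.1] -/
theorem eigenvalue_adjointCompSelf_comparison_termwise_of_iso (hdT : Dense (T.domain : Set E))
    (hdomA : ∀ x : E, x ∈ A.domain ↔ ∃ hx : x ∈ T.domain, T ⟨x, hx⟩ ∈ T†.domain)
    (hvalA : ∀ (x : A.domain) (hx : (x : E) ∈ T.domain) (hTx : T ⟨x, hx⟩ ∈ T†.domain),
      A x = T† ⟨T ⟨x, hx⟩, hTx⟩)
    (heig : ∀ i, ∃ h : (b i : E) ∈ A.domain, A ⟨b i, h⟩ = ((μ i : ℝ) : 𝕜) • (b i : E))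
    (htend : Tendsto μ cofinite atTop)
    (hdT' : Dense (T'.domain : Set E'))
    (hdomA' : ∀ x : E', x ∈ A'.domain ↔ ∃ hx : x ∈ T'.domain, T' ⟨x, hx⟩ ∈ T'†.domain)
    (hvalA' : ∀ (x : A'.domain) (hx : (x : E') ∈ T'.domain) (hTx : T' ⟨x, hx⟩ ∈ T'†.domain),
      A' x = T'† ⟨T' ⟨x, hx⟩, hTx⟩)
    (heig' : ∀ j, ∃ h : (b' j : E') ∈ A'.domain, A' ⟨b' j, h⟩ = ((μ' j : ℝ) : 𝕜) • (b' j : E'))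
    (htend' : Tendsto μ' cofinite atTop)
    (hgT : ∀ (w : E) (hw : w ∈ T.domain), ∃ h : g_E w ∈ T'.domain, T' ⟨g_E w, h⟩ = g_F (T ⟨w, hw⟩))
    (hkT : ∀ (w' : E') (hw' : w' ∈ T'.domain), ∃ h : k_E w' ∈ T.domain, T ⟨k_E w', h⟩ = k_F (T' ⟨w', hw'⟩))
    (hkg_E : ∀ w : E, k_E (g_E w) = w) (hgk_E : ∀ w' : E', g_E (k_E w') = w')
    {Mg Mk : ℝ} (hMg : 0 < Mg) (hMk : 0 < Mk) (hgE : ∀ w : E, ‖g_E w‖ ≤ Mg * ‖w‖)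
    (hgF : ∀ y : F, ‖g_F y‖ ≤ Mg * ‖y‖) (hkE : ∀ w' : E', ‖k_E w'‖ ≤ Mk * ‖w'‖)
    (hkF : ∀ y' : F', ‖k_F y'‖ ≤ Mk * ‖y'‖)
    (e : ℕ ≃ ι) (he : Monotone (μ ∘ e)) (e' : ℕ ≃ ι') (he' : Monotone (μ' ∘ e')) (n : ℕ) :
    ((Mg * Mk) ^ 2)⁻¹ * μ (e n) ≤ μ' (e' n) ∧ μ' (e' n) ≤ (Mg * Mk) ^ 2 * μ (e n) :=
  termwise_of_counting htend htend' (by positivity)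
    (ncard_eigenvalue_adjointCompSelf_lt_le_of_iso hdT hdomA hvalA heig htend hdT' hdomA' hvalA' heig' htend' hgT hkT
      hkg_E hgk_E hMg hMk hgE hgF hkE hkF) e he e' he' n

end DegreeZero

/-! ### §2 (2.52) for `Δ₂ = SS*` -/

section DegreeTwo

variable [CompleteSpace F] [CompleteSpace G] [CompleteSpace F'] [CompleteSpace G']
variable {S : F →ₗ.[𝕜] G} {C : G →ₗ.[𝕜] G} {ι : Type*} {b : HilbertBasis ι 𝕜 G} {μ : ι → ℝ}
variable {S' : F' →ₗ.[𝕜] G'} {C' : G' →ₗ.[𝕜] G'} {ι' : Type*} {b' : HilbertBasis ι' 𝕜 G'} {μ' : ι' → ℝ}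
variable {g_F : F →L[𝕜] F'} {g_G : G →L[𝕜] G'} {k_F : F' →L[𝕜] F} {k_G : G' →L[𝕜] G}

omit [NormedAddCommGroup E] [InnerProductSpace 𝕜 E] [NormedAddCommGroup E'] [InnerProductSpace 𝕜 E'] in
/-- **LEMMA 2.17 (2.52), degree `2`, as printed**: for `SS*` and `S′S′*` of isomorphic discrete complexes and increasing
enumerations of their eigenvalues, `C⁻¹λₙ ≤ λ′ₙ ≤ Cλₙ` for every `n`, `C = (M_g M_k)²`. [cite: BruningLesch1992, §2 Lemma 2.17
(2.52); Schmudgen2012, §12.1 Thm 12.1] -/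
theorem eigenvalue_selfCompAdjoint_comparison_termwise_of_iso (hdS : Dense (S.domain : Set F))
    (hdomC : ∀ y : G, y ∈ C.domain ↔ ∃ hy : y ∈ S†.domain, S† ⟨y, hy⟩ ∈ S.domain)
    (hvalC : ∀ (y : C.domain) (hy : (y : G) ∈ S†.domain) (hSy : S† ⟨y, hy⟩ ∈ S.domain),
      C y = S ⟨S† ⟨y, hy⟩, hSy⟩)
    (heig : ∀ i, ∃ h : (b i : G) ∈ C.domain, C ⟨b i, h⟩ = ((μ i : ℝ) : 𝕜) • (b i : G))
    (htend : Tendsto μ cofinite atTop)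
    (hdS' : Dense (S'.domain : Set F'))
    (hdomC' : ∀ y : G', y ∈ C'.domain ↔ ∃ hy : y ∈ S'†.domain, S'† ⟨y, hy⟩ ∈ S'.domain)
    (hvalC' : ∀ (y : C'.domain) (hy : (y : G') ∈ S'†.domain) (hSy : S'† ⟨y, hy⟩ ∈ S'.domain),
      C' y = S' ⟨S'† ⟨y, hy⟩, hSy⟩)
    (heig' : ∀ j, ∃ h : (b' j : G') ∈ C'.domain, C' ⟨b' j, h⟩ = ((μ' j : ℝ) : 𝕜) • (b' j : G'))
    (htend' : Tendsto μ' cofinite atTop)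
    (hgS : ∀ (u : F) (hu : u ∈ S.domain), ∃ h : g_F u ∈ S'.domain, S' ⟨g_F u, h⟩ = g_G (S ⟨u, hu⟩))
    (hkS : ∀ (u' : F') (hu' : u' ∈ S'.domain), ∃ h : k_F u' ∈ S.domain, S ⟨k_F u', h⟩ = k_G (S' ⟨u', hu'⟩))
    (hkg_G : ∀ z : G, k_G (g_G z) = z) (hgk_G : ∀ z' : G', g_G (k_G z') = z')
    {Mg Mk : ℝ} (hMg : 0 < Mg) (hMk : 0 < Mk) (hgF : ∀ y : F, ‖g_F y‖ ≤ Mg * ‖y‖)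
    (hgG : ∀ z : G, ‖g_G z‖ ≤ Mg * ‖z‖) (hkF : ∀ y' : F', ‖k_F y'‖ ≤ Mk * ‖y'‖)
    (hkG : ∀ z' : G', ‖k_G z'‖ ≤ Mk * ‖z'‖)
    (e : ℕ ≃ ι) (he : Monotone (μ ∘ e)) (e' : ℕ ≃ ι') (he' : Monotone (μ' ∘ e')) (n : ℕ) :
    ((Mg * Mk) ^ 2)⁻¹ * μ (e n) ≤ μ' (e' n) ∧ μ' (e' n) ≤ (Mg * Mk) ^ 2 * μ (e n) :=
  termwise_of_counting htend htend' (by positivity)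
    (ncard_eigenvalue_selfCompAdjoint_lt_le_of_iso hdS hdomC hvalC heig htend hdS' hdomC' hvalC' heig' htend' hgS hkS
      hkg_G hgk_G hMg hMk hgF hgG hkF hkG) e he e' he' n

end DegreeTwo

/-! ### §3 (2.52) for the middle Laplacian `Δ₁ = □ = TT* + S*S` -/

section Middle

variable [CompleteSpace E] [CompleteSpace F] [CompleteSpace G] [CompleteSpace E'] [CompleteSpace F']
  [CompleteSpace G']
variable {T : E →ₗ.[𝕜] F} {S : F →ₗ.[𝕜] G} {A : E →ₗ.[𝕜] E} {L : F →ₗ.[𝕜] F} {C : G →ₗ.[𝕜] G}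
variable {ι_E ι_F ι_G : Type*} {b_E : HilbertBasis ι_E 𝕜 E} {b_F : HilbertBasis ι_F 𝕜 F} {b_G : HilbertBasis ι_G 𝕜 G}
  {μ_E : ι_E → ℝ} {μ_F : ι_F → ℝ} {μ_G : ι_G → ℝ}
variable {T' : E' →ₗ.[𝕜] F'} {S' : F' →ₗ.[𝕜] G'} {A' : E' →ₗ.[𝕜] E'} {L' : F' →ₗ.[𝕜] F'} {C' : G' →ₗ.[𝕜] G'}
variable {ι'_E ι'_F ι'_G : Type*} {b'_E : HilbertBasis ι'_E 𝕜 E'} {b'_F : HilbertBasis ι'_F 𝕜 F'}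
  {b'_G : HilbertBasis ι'_G 𝕜 G'} {μ'_E : ι'_E → ℝ} {μ'_F : ι'_F → ℝ} {μ'_G : ι'_G → ℝ}
variable {g_E : E →L[𝕜] E'} {g_F : F →L[𝕜] F'} {g_G : G →L[𝕜] G'}
  {k_E : E' →L[𝕜] E} {k_F : F' →L[𝕜] F} {k_G : G' →L[𝕜] G}

/-- **LEMMA 2.17 (2.52), middle degree, as printed**: for the middle Laplacians `□`, `□′` of isomorphic discrete short
complexes (all three Laplacians on each side with eigenbases, `‖g‖ ≤ M_g`, `‖k‖ ≤ M_k` in all degrees) and increasing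
enumerations `λₙ = μ_F(e n)`, `λ′ₙ = μ′_F(e′ n)`: `C⁻¹λₙ ≤ λ′ₙ ≤ Cλₙ` for every `n`, `C = (M_g M_k)²`.
[cite: BruningLesch1992, §2 Lemma 2.17 (2.52); Gilkey1995, §1.6 Lemma 1.6.5; Schmudgen2012, §12.1 Thm 12.1] -/
theorem eigenvalue_laplacian_comparison_termwise_of_iso (hdT : Dense (T.domain : Set E))
    (hdS : Dense (S.domain : Set F)) (hcS : S.IsClosed)
    (hST : LinearMap.range T.toFun ≤ (LinearMap.ker S.toFun).map S.domain.subtype)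
    (hdomA : ∀ x : E, x ∈ A.domain ↔ ∃ hx : x ∈ T.domain, T ⟨x, hx⟩ ∈ T†.domain)
    (hvalA : ∀ (x : A.domain) (hx : (x : E) ∈ T.domain) (hTx : T ⟨x, hx⟩ ∈ T†.domain),
      A x = T† ⟨T ⟨x, hx⟩, hTx⟩)
    (hdom : ∀ x : F, x ∈ L.domain ↔ (∃ hxT : x ∈ T†.domain, T† ⟨x, hxT⟩ ∈ T.domain) ∧
      (∃ hxS : x ∈ S.domain, S ⟨x, hxS⟩ ∈ S†.domain))
    (hval : ∀ (x : L.domain) (hxT : (x : F) ∈ T†.domain) (hTx : T† ⟨x, hxT⟩ ∈ T.domain)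
      (hxS : (x : F) ∈ S.domain) (hSx : S ⟨x, hxS⟩ ∈ S†.domain),
      L x = T ⟨T† ⟨x, hxT⟩, hTx⟩ + S† ⟨S ⟨x, hxS⟩, hSx⟩)
    (hdomC : ∀ y : G, y ∈ C.domain ↔ ∃ hy : y ∈ S†.domain, S† ⟨y, hy⟩ ∈ S.domain)
    (hvalC : ∀ (y : C.domain) (hy : (y : G) ∈ S†.domain) (hSy : S† ⟨y, hy⟩ ∈ S.domain),
      C y = S ⟨S† ⟨y, hy⟩, hSy⟩)
    (heig_E : ∀ i, ∃ h : (b_E i : E) ∈ A.domain, A ⟨b_E i, h⟩ = ((μ_E i : ℝ) : 𝕜) • (b_E i : E))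
    (heig_F : ∀ j, ∃ h : (b_F j : F) ∈ L.domain, L ⟨b_F j, h⟩ = ((μ_F j : ℝ) : 𝕜) • (b_F j : F))
    (heig_G : ∀ k, ∃ h : (b_G k : G) ∈ C.domain, C ⟨b_G k, h⟩ = ((μ_G k : ℝ) : 𝕜) • (b_G k : G))
    (htend_E : Tendsto μ_E cofinite atTop) (htend_F : Tendsto μ_F cofinite atTop)
    (htend_G : Tendsto μ_G cofinite atTop)
    (hdT' : Dense (T'.domain : Set E')) (hdS' : Dense (S'.domain : Set F')) (hcS' : S'.IsClosed)
    (hST' : LinearMap.range T'.toFun ≤ (LinearMap.ker S'.toFun).map S'.domain.subtype)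
    (hdomA' : ∀ x : E', x ∈ A'.domain ↔ ∃ hx : x ∈ T'.domain, T' ⟨x, hx⟩ ∈ T'†.domain)
    (hvalA' : ∀ (x : A'.domain) (hx : (x : E') ∈ T'.domain) (hTx : T' ⟨x, hx⟩ ∈ T'†.domain),
      A' x = T'† ⟨T' ⟨x, hx⟩, hTx⟩)
    (hdom' : ∀ x : F', x ∈ L'.domain ↔ (∃ hxT : x ∈ T'†.domain, T'† ⟨x, hxT⟩ ∈ T'.domain) ∧
      (∃ hxS : x ∈ S'.domain, S' ⟨x, hxS⟩ ∈ S'†.domain))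
    (hval' : ∀ (x : L'.domain) (hxT : (x : F') ∈ T'†.domain) (hTx : T'† ⟨x, hxT⟩ ∈ T'.domain)
      (hxS : (x : F') ∈ S'.domain) (hSx : S' ⟨x, hxS⟩ ∈ S'†.domain),
      L' x = T' ⟨T'† ⟨x, hxT⟩, hTx⟩ + S'† ⟨S' ⟨x, hxS⟩, hSx⟩)
    (hdomC' : ∀ y : G', y ∈ C'.domain ↔ ∃ hy : y ∈ S'†.domain, S'† ⟨y, hy⟩ ∈ S'.domain)
    (hvalC' : ∀ (y : C'.domain) (hy : (y : G') ∈ S'†.domain) (hSy : S'† ⟨y, hy⟩ ∈ S'.domain),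
      C' y = S' ⟨S'† ⟨y, hy⟩, hSy⟩)
    (heig'_E : ∀ i, ∃ h : (b'_E i : E') ∈ A'.domain, A' ⟨b'_E i, h⟩ = ((μ'_E i : ℝ) : 𝕜) • (b'_E i : E'))
    (heig'_F : ∀ j, ∃ h : (b'_F j : F') ∈ L'.domain, L' ⟨b'_F j, h⟩ = ((μ'_F j : ℝ) : 𝕜) • (b'_F j : F'))
    (heig'_G : ∀ k, ∃ h : (b'_G k : G') ∈ C'.domain, C' ⟨b'_G k, h⟩ = ((μ'_G k : ℝ) : 𝕜) • (b'_G k : G'))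
    (htend'_E : Tendsto μ'_E cofinite atTop) (htend'_F : Tendsto μ'_F cofinite atTop)
    (htend'_G : Tendsto μ'_G cofinite atTop)
    (hgT : ∀ (w : E) (hw : w ∈ T.domain), ∃ h : g_E w ∈ T'.domain, T' ⟨g_E w, h⟩ = g_F (T ⟨w, hw⟩))
    (hgS : ∀ (u : F) (hu : u ∈ S.domain), ∃ h : g_F u ∈ S'.domain, S' ⟨g_F u, h⟩ = g_G (S ⟨u, hu⟩))
    (hkT : ∀ (w' : E') (hw' : w' ∈ T'.domain), ∃ h : k_E w' ∈ T.domain, T ⟨k_E w', h⟩ = k_F (T' ⟨w', hw'⟩))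
    (hkS : ∀ (u' : F') (hu' : u' ∈ S'.domain), ∃ h : k_F u' ∈ S.domain, S ⟨k_F u', h⟩ = k_G (S' ⟨u', hu'⟩))
    (hkg_E : ∀ w : E, k_E (g_E w) = w) (hgk_E : ∀ w' : E', g_E (k_E w') = w')
    (hkg_F : ∀ u : F, k_F (g_F u) = u) (hgk_F : ∀ u' : F', g_F (k_F u') = u')
    (hkg_G : ∀ z : G, k_G (g_G z) = z) (hgk_G : ∀ z' : G', g_G (k_G z') = z')
    {Mg Mk : ℝ} (hMg : 0 < Mg) (hMk : 0 < Mk) (hgE : ∀ w : E, ‖g_E w‖ ≤ Mg * ‖w‖)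
    (hgF : ∀ y : F, ‖g_F y‖ ≤ Mg * ‖y‖) (hgG : ∀ z : G, ‖g_G z‖ ≤ Mg * ‖z‖)
    (hkE : ∀ w' : E', ‖k_E w'‖ ≤ Mk * ‖w'‖) (hkF : ∀ y' : F', ‖k_F y'‖ ≤ Mk * ‖y'‖)
    (hkG : ∀ z' : G', ‖k_G z'‖ ≤ Mk * ‖z'‖)
    (e : ℕ ≃ ι_F) (he : Monotone (μ_F ∘ e)) (e' : ℕ ≃ ι'_F) (he' : Monotone (μ'_F ∘ e')) (n : ℕ) :
    ((Mg * Mk) ^ 2)⁻¹ * μ_F (e n) ≤ μ'_F (e' n) ∧ μ'_F (e' n) ≤ (Mg * Mk) ^ 2 * μ_F (e n) :=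
  termwise_of_counting htend_F htend'_F (by positivity)
    (ncard_eigenvalue_laplacian_comparison_of_iso hdT hdS hcS hST hdomA hvalA hdom hval hdomC hvalC heig_E heig_F heig_G
      htend_E htend_F htend_G hdT' hdS' hcS' hST' hdomA' hvalA' hdom' hval' hdomC' hvalC' heig'_E heig'_F heig'_G htend'_E
      htend'_F htend'_G hgT hgS hkT hkS hkg_E hgk_E hkg_F hgk_F hkg_G hgk_G hMg hMk hgE hgF hgG hkE hkF hkG)
    e he e' he' n

end Middle

end Literature.Analysis.InnerProduct
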